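import Literature.AlgebraicGeometry.Milne1999.CMTypeSimpleIsogenyFactors
import Literature.AlgebraicGeometry.ComplexMultiplication.ShimuraIsogenyHolds
import Literature.AlgebraicGeometry.Motives.AbelianVarietyProjectiveChart
import Literature.AlgebraicGeometry.HodgeTheory.ComplexConjugationHolds
import HarnessLib

/-!
# Milne 1999, Theorem 7.1: the hypothesis (H) EXACTLY AS PRINTED is the tree's `∀ A, CMHodgeHypothesisAt A`

Citation-fit record for row CF12 of the Hodge-CM citation manifest (`hodge-director/CITATION-FIT.md`,
cell pub-hodgecm2).  J. S. Milne, *Lefschetz motives and the Tate conjecture*, Compositio Math. **117**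
(1999) 45–76 [Milne1999], held text `paper:doi-10-1023-a-1000776613765` (PDF page = printed page − 44),
re-read for this file:

* p. 54 (`p0010.txt` L5–6): «Throughout this section, `C` is an algebraically closed field of
  characteristic zero […]»; (L15–17): «A simple Abelian variety `A` over `C` is said to be of CM-type if
  `End⁰(A)` is a field (necessarily CM) of degree `2 dim A` over `Q`, and an arbitrary Abelian variety
  over `C` is said to be of CM-type if all its simple isogeny factors are of CM-type.»
* p. 72 (`p0028.txt` L10–12): «Let `X` be a smooth projective variety over `C`. We say that the Hodge
  conjecture holds for `X` if, for all `r`, the `Q`-vector space `H^{2r}(X(C), Q) ∩ H^{r,r}` is spanned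
  by the classes of algebraic cycles.»; (L14–15): «THEOREM 7.1. If the Hodge conjecture holds for all
  Abelian varieties of CM-type over `C`, then the Tate conjecture (0.1) holds for all Abelian varieties
  over the algebraic closure `F` of a finite field.»
* p. 47 (`p0003.txt` L5–11), Remark (a): «For a simple Abelian variety `A` over a field of characteristic
  zero, `E ⊂ End(A) ⊗ Q`, `E` a field, `[E : Q] = 2 dim A ⇒ E` is a CM-field».

The tree TYPES the hypothesis (H) of Theorem 7.1 as `∀ A : AbelianVariety ℂ, Milne1999.CMHodgeHypothesisAt A`
(file `HodgeCMImpliesTateFiniteFields`), i.e.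
`∀ A, IsSmoothProjective A.dim A.X → IsOfCMType A → HodgeConjectureFor A.dim A.X`, which is — by `Iff.rfl`
— the Summits item `RankFourFaces.CMAbelianHodge` and the COR-CM target `HC_CM`
(`Summit.HodgeConjecture.CorCM.hc_cm_iff_forall_cmHodgeHypothesisAt`, `CorCM/Interfaces.lean` l. 74).  Three
wordings of the typed (H) differ from print:

* (a) «of CM-type» is rendered in the étale form `IsOfCMType A` (`End⁰(A)` contains a commutative reduced
  `ℚ`-subalgebra of dimension `2 dim A`), not by simple isogeny factors;
* (b) a smooth-projectivity premiss `IsSmoothProjective A.dim A.X` is carried (in print abelian varieties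
  are smooth projective varieties, and p. 72 speaks of «a smooth projective variety `X`»);
* (c) «the Hodge conjecture holds for `X`» is the summit's `HodgeConjectureFor n X`, whose first conjunct
  `Nonempty (HodgeModel n X)` is an anti-vacuity clause absent from print and whose second conjunct is
  the cycle clause.

This file PROVES that the typed (H) is equivalent to (H) with (a), (b), (c) read exactly as printed:
(a) by `isOfCMType_iff_isOfCMTypeMilne` (file `CMTypeSimpleIsogenyFactors`; `IsOfCMTypeMilne A` := every
simple isogeny factor `B` of `A` has `End⁰(B)` a field of degree `2 dim B` — Milne's sentence verbatim),
(b) by `AbelianVariety.isSmoothProjective_holds` (already in the tree as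
`cmHodgeHypothesisAt_iff_of_isSmoothProjective`, file `CMHodgeHypothesisFromCMTypedProducts`), (c) by
`nonempty_hodgeModel_holds` — see
`cmHodgeHypothesisAt_iff_printedH` (per variety) and `forall_cmHodgeHypothesisAt_iff_printedH` (closed).
It also records the two remaining printed items: the parenthetical «(necessarily CM)» is a THEOREM
(`IsOfCMTypeSimple.isCMField_endField`, from `ComplexMultiplication.isCMField_endField_of_isSimple`,
Shimura 1998 §5.1 Prop. 5 at Riemann's theorem `deligneMilne1982_Thm_6_20_full_holds`), and Theorem 7.1
itself stays the cited record `Theorem71 E`, consumed only DOWNSTREAM of (H)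
(`tateStatement01_of_printedH`) — it is not an input of any proof OF (H).
Theorems only; no definition, no named fact (D-0026).

Dictionary for (c).  Print's «`H^{2r}(X(C), ℚ) ∩ H^{r,r}` is spanned by the classes of algebraic cycles»
⟺ every RATIONAL class (`IsRationalClass`: in the image of `H^{2r}(X(ℂ); ℚ) → H^{2r}(X(ℂ); ℂ)`) of Hodge
TYPE `(r,r)` (`IsOfHodgeType`) lies in `algebraicClasses X r` (the span of the cycle classes): for a
rational class, being a `ℂ`-combination of the (rational) classes `cl(Z)` is being a `ℚ`-combination
(module docstring of `HodgeTheory/HodgeConjecture`, after Deligne 2000 §1).  This is the summit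
statement's own reading of «Hodge classes are algebraic» and is not re-derived here.

## References
* [Milne1999] J. S. Milne, Lefschetz motives and the Tate conjecture, Compositio Math. 117 (1999) 45–76:
  §2 p. 54 (CM-type), §7 p. 72 (Thm. 7.1; «the Hodge conjecture holds for `X`»), (0.1) p. 46,
  Remark (a) p. 47.
* [Shimura1998] G. Shimura, *Abelian Varieties with Complex Multiplication and Modular Functions*
  (1998), §5.1 Prop. 5.
* [Deligne1982HodgeCycles] P. Deligne, Hodge cycles on abelian varieties, LNM 900 (1982), §5 Prop. 5.1.
* [Deligne2000] P. Deligne, The Hodge conjecture, Clay Mathematics Institute (2000), §1.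
-/

noncomputable section

namespace Literature.AlgebraicGeometry.Milne1999

open NumberField
open Literature.AlgebraicGeometry.Motives Literature.AlgebraicGeometry.HodgeTheory
open Literature.AlgebraicGeometry.ComplexMultiplication

variable {A B : AbelianVariety ℂ}

/-! ## §1 The anti-vacuity conjunct is a theorem
(the smooth-projectivity premiss (b) is already discharged in the tree:
`cmHodgeHypothesisAt_iff_of_isSmoothProjective`, file `CMHodgeHypothesisFromCMTypedProducts`) -/

/-- «The Hodge conjecture holds for `A`» (p. 72), `A` a complex abelian variety, is exactly its cycle
clause: for all `r`, every rational `(r,r)`-class in `H^{2r}(A(ℂ); ℂ)` lies in the span of the classes of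
algebraic cycles — the Hodge-model conjunct of `HodgeConjectureFor` is discharged by
`nonempty_hodgeModel_holds` at `AbelianVariety.isSmoothProjective_holds`. [cite: Milne1999, §7 p. 72]
[cite: Deligne2000, §1] -/
theorem hodgeConjectureFor_abelianVariety_iff (A : AbelianVariety ℂ) :
    HodgeConjectureFor A.dim A.X ↔
      ∀ (r : ℕ) (c : Literature.AlgebraicTopology.SingularHomology.singularCohomology ℂ ℂ
        (Motives.ComplexPoints A.X) (2 * r)),
        IsRationalClass c → IsOfHodgeType A.dim A.X (2 * r) r r c → c ∈ algebraicClasses A.X r :=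
  hodgeConjectureFor_iff_of_isSmoothProjective nonempty_hodgeModel_holds
    AbelianVariety.isSmoothProjective_holds

/-! ## §2 (H) exactly as printed -/

/-- **(H) at one abelian variety, exactly as printed.**  The typed hypothesis `CMHodgeHypothesisAt A`
holds iff: provided all simple isogeny factors `B` of `A` have `End⁰(B)` a field of degree `2 dim B`
(p. 54 verbatim, `IsOfCMTypeMilne A`), for all `r` every rational `(r,r)`-class in `H^{2r}(A(ℂ); ℂ)` lies in
the span of the classes of algebraic cycles (p. 72 verbatim); no smooth-projectivity premiss, no
Hodge-model conjunct. [cite: Milne1999, §2 p. 54 and §7 p. 72] -/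
theorem cmHodgeHypothesisAt_iff_printedH (A : AbelianVariety ℂ) :
    CMHodgeHypothesisAt A ↔
      (IsOfCMTypeMilne A →
        ∀ (r : ℕ) (c : Literature.AlgebraicTopology.SingularHomology.singularCohomology ℂ ℂ
          (Motives.ComplexPoints A.X) (2 * r)),
          IsRationalClass c → IsOfHodgeType A.dim A.X (2 * r) r r c → c ∈ algebraicClasses A.X r) := by
  rw [cmHodgeHypothesisAt_iff_of_isSmoothProjective, isOfCMType_iff_isOfCMTypeMilne,
    hodgeConjectureFor_abelianVariety_iff]

/-- **The hypothesis (H) of Theorem 7.1, exactly as printed, is the tree's `∀ A, CMHodgeHypothesisAt A`**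
(which is `RankFourFaces.CMAbelianHodge` and `CorCM.HC_CM` by `Iff.rfl`): «the Hodge conjecture holds for
all Abelian varieties of CM-type over `C`», with «of CM-type» := all simple isogeny factors `B` have
`End⁰(B)` a field of degree `2 dim B` (p. 54) and «holds for `X`» := for all `r`, the rational
`(r,r)`-classes lie in the span of the classes of algebraic cycles (p. 72).
[cite: Milne1999, §2 p. 54 and §7 Thm. 7.1 p. 72] -/
theorem forall_cmHodgeHypothesisAt_iff_printedH :
    (∀ A : AbelianVariety ℂ, CMHodgeHypothesisAt A) ↔
      ∀ A : AbelianVariety ℂ, IsOfCMTypeMilne A →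
        ∀ (r : ℕ) (c : Literature.AlgebraicTopology.SingularHomology.singularCohomology ℂ ℂ
          (Motives.ComplexPoints A.X) (2 * r)),
          IsRationalClass c → IsOfHodgeType A.dim A.X (2 * r) r r c → c ∈ algebraicClasses A.X r :=
  forall_congr' cmHodgeHypothesisAt_iff_printedH

/-- The same with «holds for `X`» kept as the tree's `HodgeConjectureFor` (only (a) and (b) read as
printed): `(∀ A, CMHodgeHypothesisAt A) ↔ ∀ A, IsOfCMTypeMilne A → HodgeConjectureFor A.dim A.X` — the
variant of `forall_cmHodgeHypothesisAt_iff_milneDef` without the smooth-projectivity premiss.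
[cite: Milne1999, §2 p. 54 and §7 Thm. 7.1 p. 72] -/
theorem forall_cmHodgeHypothesisAt_iff_milneDef' :
    (∀ A : AbelianVariety ℂ, CMHodgeHypothesisAt A) ↔
      ∀ A : AbelianVariety ℂ, IsOfCMTypeMilne A → HodgeConjectureFor A.dim A.X := by
  refine forall_congr' fun A => ?_
  rw [cmHodgeHypothesisAt_iff_of_isSmoothProjective, isOfCMType_iff_isOfCMTypeMilne]

/-! ## §3 The parenthetical «(necessarily CM)» is a theorem -/

/-- **«`End⁰(A)` is a field (necessarily CM) of degree `2 dim A`»** (p. 54, the parenthetical; p. 47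
Remark (a)): for a simple complex abelian variety `B` of positive dimension with `End⁰(B)` a field of
degree `2 dim B` (`IsOfCMTypeSimple B`), that field is a CM field — the tree's
`ComplexMultiplication.isCMField_endField_of_isSimple` (Shimura 1998 §5.1 Prop. 5 / Deligne 1982
Prop. 5.1, unconditional since `deligneMilne1982_Thm_6_20_full_holds`), read on Milne's clause.
[cite: Milne1999, §2 p. 54 and Remark (a) p. 47] [cite: Shimura1998, §5.1 Proposition 5]
[cite: Deligne1982HodgeCycles, §5 Prop. 5.1] -/
theorem IsOfCMTypeSimple.isCMField_endField (hB : AbelianVariety.IsSimple B) (hB0 : 0 < B.dim)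
    (h : IsOfCMTypeSimple B) : IsCMField (EndField B h.1) :=
  isCMField_endField_of_isSimple hB hB0 h.isOfCMType

/-- The parenthetical at every simple isogeny factor of an abelian variety of CM-type in Milne's
wording: each simple isogeny factor `B` of `A` has `End⁰(B)` a CM field (of degree `2 dim B`).
[cite: Milne1999, §2 p. 54] [cite: Shimura1998, §5.1 Proposition 5] -/
theorem IsOfCMTypeMilne.isCMField_endField (hA : IsOfCMTypeMilne A) (hB : IsSimpleIsogenyFactor B A) :
    IsCMField (EndField B (hA B hB).1) :=
  (hA B hB).isCMField_endField hB.1 hB.2.1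

/-! ## §4 Theorem 7.1 composes with (H) as printed -/

/-- **Theorem 7.1 on the printed hypothesis.**  The cited record `Theorem71 E` (Milne's theorem at the
intended ℓ-adic data `E`) and (H) exactly as printed give Tate's (0.1) for every abelian variety over
every finite field (`TateStatement01 E`).  The record is consumed only here, downstream of (H).
[cite: Milne1999, §7 Thm. 7.1 p. 72 and (0.1) p. 46] -/
theorem tateStatement01_of_printedH
    {E : ∀ (k : Type) [Field k] [Finite k] (ℓ : ℕ) [Fact ℓ.Prime] [NeZero (ℓ : k)],
      GaloisWeilCohomology k ℚ_[ℓ] (padicCyclotomicCharacter k ℓ)}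
    (h71 : Theorem71 E)
    (hH : ∀ A : AbelianVariety ℂ, IsOfCMTypeMilne A →
      ∀ (r : ℕ) (c : Literature.AlgebraicTopology.SingularHomology.singularCohomology ℂ ℂ
        (Motives.ComplexPoints A.X) (2 * r)),
        IsRationalClass c → IsOfHodgeType A.dim A.X (2 * r) r r c → c ∈ algebraicClasses A.X r) :
    TateStatement01 E :=
  tateAV_Fq_of_HC_CM h71 (forall_cmHodgeHypothesisAt_iff_printedH.2 hH)

end Literature.AlgebraicGeometry.Milne1999

end
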